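import Summits.BirchSwinnertonDyer.BirchSwinnertonDyer.Theorems.QuadraticBranchSignedControlPlusEtaLowerInclusionValuationSqueezeLeadingCoeff
import Literature.NumberTheory.EllipticCurves.IwasawaAlgebraProofs
import Mathlib.GroupTheory.Torsion
import HarnessLib

/-!
# Route `QuadraticBranchSignedControl` (rung K8, cell `bsd-potss`), crux `PlusEtaLowerInclusion`
# (item stmt-BirchSwinnertonDyer-19601): the TORSION of `X_η/TX_η` divides the leading coefficient of
# `Char X⁺(V/K_∞)^η` — the crux at a tower-onto pair of any rank from the TORSION of the
# `Γ`-coinvariants (the quantity the bottom-layer CONTROL map sees)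

WHAT. Fifth file of the valuation-squeeze road (p499967, p500695, p502879, p503867). p502879 identified
the `r`-th coefficient (`r = rank V^{(p*)}(ℚ)`) of a characteristic power series `ξ_η` of
`X_η = X⁺(V/K₀ℚ_∞)^η` at a tower-onto pair (named facts + `V`-certificate + `coeff_r L_p⁺(V,η,T) ≠ 0`)
with `#coker(φ : X_η[T] → X_η/TX_η)` up to a unit. THIS FILE proves

  `#(X_η/TX_η)_tors ∣ #coker φ`      (Kitajima–Otsuki at `η`: `X_η[T]` is `ℤ`-torsion-free, `ker φ = 0`),

so that the crux at the pair follows from `p^v ∣ #(X_η/TX_η)_tors` (§3). WHY THIS FORM: `X_η/TX_η` is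
the Pontryagin dual of the `Γ`-invariants `S^Γ` of `S = Sel⁺(V/K₀ℚ_∞)^η` and its torsion is dual to
`S^Γ / S^Γ_div`; the bottom-layer control map `Sel_{p^∞}(W/ℚ) → S^Γ` has divisible image of the SAME
corank (a divisible subgroup of finite index in a divisible group is everything), so
`#(S^Γ/S^Γ_div) ≥ #coker(Sel_{p^∞}(W/ℚ) → S^Γ)` — the TAMAGAWA-visible defect of ctrl's control files
(`QuadraticBranchEvenControlDefect`: `≤ ∏_ℓ p^{ord_p c_ℓ(W)}`; in rank one `≥ #K_Tam/exp K_Tam` by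
Poitou–Tate, NOT proved here). None of these further identifications is proved in this file.

Chain: §1 (pure `Λ`-algebra) for a finitely generated torsion `Λ`-module `M` in which every FINITE
`Λ`-submodule vanishes: `M[T]` has no `ℤ`-torsion (`M[T] ∩ M[p^a]` is finitely generated, killed by
`T`, of local length `0` at `(T)` since `p^a ∉ (T)` — hence finite — hence `0`; a prime-to-`p` integer
acts invertibly); §2 if moreover `ker φ = 0` then `(M/TM)_tors → coker φ` is injective, so
`#(M/TM)_tors ∣ #coker φ`; §3 the `η`-datum at a tower-onto pair: `ker φ = 0` (p502879's argument) and
the road `quadraticBranchPlusEtaLowerInclusionAt_of_namedFacts_of_certV_of_torsionCoinvariantsDvd`.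

HONEST FRAMING (cell `bsd-potss`, run/shared/lean/pub/bsd-potss/; FULL-BSD rank ≤ 1 programme, HUMAN
RULING D-0036/D-0074): TOOL THEOREMS ONLY, CONDITIONAL on the named Literature facts (Kobayashi 2003
Thm. 1.2/1.3/2.2η/4.1η, Kitajima–Otsuki 2018 Thm. 1.3 at `η`; hypothesis position), on the tower-onto
hypothesis, the `V`-certificate and the analytic certificate (NOT supplied here for any pair), and in §3
on the per-pair torsion input (OPEN on the rank-one rows). The crux 19601 is OPEN class-wide and NOT
closed; nothing is booked; `BSD(W, p)` is claimed for no pair. No definition, no named fact, no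
`sorry`, axioms standard. Seat `bsd-potss-k8eta-c1` (prover), g3; `--supports stmt-BirchSwinnertonDyer-19601`.

References: [Kobayashi2003] Thm. 2.2, §4 + Thm. 4.1; [KitajimaOtsuki2018] Thm. 1.3;
[CoatesSchneiderSujatha2003] §3 (30)–(31); [GreenbergLNM1716] §3 Lemma 3.1–3.3, §4; [Washington1997] §13.2.
-/

set_option autoImplicit false
set_option linter.dupNamespace false
noncomputable section

open scoped Classical
open CongruenceSubgroup Field WeierstrassCurve
open Literature.NumberTheory.EllipticCurves
open Literature.NumberTheory.EllipticCurves.ModularForms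
open Literature.NumberTheory.GaloisRepresentations
open Summit.BirchSwinnertonDyer.Rank1Residual.Additive

namespace Summit.BirchSwinnertonDyer.BirchSwinnertonDyer.Theorems

/-! ## §1 `M[T]` is torsion-free when finite submodules vanish -/

section Algebra

variable {p : ℕ} [Fact p.Prime] {M : Type} [AddCommGroup M] [Module (IwasawaAlgebra p) M]

/-- **In a finitely generated torsion `Λ`-module whose finite `Λ`-submodules vanish, `M[T]` has no
`p`-power torsion**: `M[T] ∩ M[p^a]` is a finitely generated `Λ`-module killed by `T` and by `p^a`;
as `p^a ∉ (T)` its local length at `(T)` is `0`, so it is FINITE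
(`IwasawaAlgebra.finite_iff_lengthAt_eq_zero_of_X_smul_eq_zero`), hence `0`. [folklore] -/
theorem eq_zero_of_X_smul_eq_zero_of_pow_smul_eq_zero [Module.Finite (IwasawaAlgebra p) M]
    (hnf : ∀ N : Submodule (IwasawaAlgebra p) M, Finite N → N = ⊥) {x : M}
    (hx : (PowerSeries.X : IwasawaAlgebra p) • x = 0) {a : ℕ}
    (hpx : ((p : IwasawaAlgebra p) ^ a) • x = 0) : x = 0 := by
  let U : Submodule (IwasawaAlgebra p) M :=
    IwasawaAlgebra.invariants p M ⊓ Submodule.torsionBy (IwasawaAlgebra p) M ((p : IwasawaAlgebra p) ^ a)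
  have hxU : x ∈ U :=
    ⟨(IwasawaAlgebra.mem_invariants_iff p M x).mpr hx, (Submodule.mem_torsionBy_iff _ _).mpr hpx⟩
  haveI : IsNoetherian (IwasawaAlgebra p) M := isNoetherian_of_isNoetherianRing_of_finite _ _
  haveI : Module.Finite (IwasawaAlgebra p) U := Module.Finite.iff_fg.mpr (IsNoetherian.noetherian U)
  have hT : ∀ u : U, (PowerSeries.X : IwasawaAlgebra p) • u = 0 := fun u =>
    Subtype.ext ((IwasawaAlgebra.mem_invariants_iff p M _).mp u.2.1)
  have htors : Module.IsTorsionBy (IwasawaAlgebra p) U ((p : IwasawaAlgebra p) ^ a) := fun u =>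
    Subtype.ext ((Submodule.mem_torsionBy_iff _ _).mp u.2.2)
  have hnot : (p : IwasawaAlgebra p) ^ a ∉ (IwasawaAlgebra.primeT p).asIdeal := by
    rw [IwasawaAlgebra.primeT_asIdeal, Ideal.mem_span_singleton, ← map_natCast (PowerSeries.C),
      ← map_pow, PowerSeries.X_dvd_iff, PowerSeries.constantCoeff_C]
    exact pow_ne_zero _ (Nat.cast_ne_zero.mpr (Fact.out : p.Prime).ne_zero)
  have hlen : Module.lengthAt (IwasawaAlgebra p) U (IwasawaAlgebra.primeT p) = 0 :=
    Module.lengthAt_eq_zero_of_isTorsionBy htors _ hnot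
  have hfin : Finite U :=
    (IwasawaAlgebra.finite_iff_lengthAt_eq_zero_of_X_smul_eq_zero p (P := U) hT).mpr hlen
  have hbot : U = ⊥ := hnf U hfin
  have : x ∈ (⊥ : Submodule (IwasawaAlgebra p) M) := hbot ▸ hxU
  exact (Submodule.mem_bot _).mp this

/-- **… hence `M[T]` is `ℤ`-torsion-free**: if `n • x = 0` with `n ≠ 0` then `x = 0` (write
`n = p^a m`, `p ∤ m`; `m` is a unit of `Λ`). [folklore] -/
theorem eq_zero_of_X_smul_eq_zero_of_nsmul_eq_zero [Module.Finite (IwasawaAlgebra p) M]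
    (hnf : ∀ N : Submodule (IwasawaAlgebra p) M, Finite N → N = ⊥) {x : M}
    (hx : (PowerSeries.X : IwasawaAlgebra p) • x = 0) {n : ℕ} (hn : n ≠ 0) (hnx : n • x = 0) :
    x = 0 := by
  have hp : p.Prime := Fact.out
  obtain ⟨a, m, hm, rfl⟩ := Nat.exists_eq_pow_mul_and_not_dvd hn p hp.ne_one
  -- `p^a • (m • x) = 0`, and `m • x ∈ M[T]`
  have h1 : ((p : IwasawaAlgebra p) ^ a) • ((m : IwasawaAlgebra p) • x) = 0 := by
    rw [← mul_smul, ← Nat.cast_pow, ← Nat.cast_mul, Nat.cast_smul_eq_nsmul, hnx]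
  have h2 : (PowerSeries.X : IwasawaAlgebra p) • ((m : IwasawaAlgebra p) • x) = 0 := by
    rw [smul_comm, hx, smul_zero]
  have h3 : (m : IwasawaAlgebra p) • x = 0 :=
    eq_zero_of_X_smul_eq_zero_of_pow_smul_eq_zero hnf h2 h1
  -- `m` is a unit of `Λ` (its constant coefficient is a unit of `ℤ_p`; cf. the tree's
  -- `CongruentShaFreeCutKatoKummerLogTorsion.isUnit_natCast_iwasawaAlgebra_of_not_dvd`, not imported)
  have hunit : IsUnit ((m : ℕ) : IwasawaAlgebra p) := by
    rw [PowerSeries.isUnit_iff_constantCoeff, map_natCast, PadicInt.isUnit_iff]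
    refine le_antisymm (PadicInt.norm_le_one _) (not_lt.mp fun hlt ↦ hm ?_)
    have h := (PadicInt.norm_int_lt_one_iff_dvd (p := p) (m : ℤ)).mp (by exact_mod_cast hlt)
    exact_mod_cast h
  obtain ⟨u, hu⟩ := hunit
  have h4 : (↑u⁻¹ * (m : IwasawaAlgebra p)) • x = 0 := by rw [mul_smul, h3, smul_zero]
  rwa [← hu, Units.inv_mul, one_smul] at h4

/-! ## §2 `#(M/TM)_tors ∣ #coker φ` -/

/-- **If finite `Λ`-submodules of `M` vanish and `ker φ_M = 0` then the torsion subgroup of `M/TM`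
injects into `coker(φ_M : M[T] → M/TM)`**, so `#(M/TM)_tors ∣ #coker φ_M` (`Nat.card`): a torsion
class in the image of `φ_M` lifts to a torsion element of the torsion-free `M[T]`.
[cite: CoatesSchneiderSujatha2003, §3 (30) (the map φ)] -/
theorem natCard_torsion_coinvariants_dvd_natCard_coker_bockstein [Module.Finite (IwasawaAlgebra p) M]
    (hnf : ∀ N : Submodule (IwasawaAlgebra p) M, Finite N → N = ⊥)
    (hker : LinearMap.ker (IwasawaAlgebra.bockstein p M) = ⊥) :
    Nat.card (AddCommGroup.torsion (IwasawaAlgebra.coinvariants p M)) ∣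
      Nat.card (IwasawaAlgebra.coinvariants p M ⧸ LinearMap.range (IwasawaAlgebra.bockstein p M)) := by
  let π : IwasawaAlgebra.coinvariants p M →+
      IwasawaAlgebra.coinvariants p M ⧸ LinearMap.range (IwasawaAlgebra.bockstein p M) :=
    (Submodule.mkQ _).toAddMonoidHom
  let ι := π.comp (AddCommGroup.torsion (IwasawaAlgebra.coinvariants p M)).subtype
  refine AddSubgroup.card_dvd_of_injective ι fun y₁ y₂ h => ?_
  -- reduce to: a torsion element of the image of `φ` is `0`
  rw [← sub_eq_zero]
  apply Subtype.ext
  have hy : ι (y₁ - y₂) = 0 := by rw [map_sub, h, sub_self]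
  have hmem : ((y₁ - y₂ : AddCommGroup.torsion (IwasawaAlgebra.coinvariants p M)) :
      IwasawaAlgebra.coinvariants p M) ∈ LinearMap.range (IwasawaAlgebra.bockstein p M) := by
    have : π (y₁ - y₂ : AddCommGroup.torsion _) = 0 := hy
    exact (Submodule.Quotient.mk_eq_zero _).mp this
  obtain ⟨x, hx⟩ := LinearMap.mem_range.mp hmem
  -- the torsion exponent
  obtain ⟨n, hn, hny⟩ := ((AddCommGroup.mem_torsion _).mp (y₁ - y₂).2).exists_nsmul_eq_zero
  have hnx : n • x ∈ LinearMap.ker (IwasawaAlgebra.bockstein p M) := by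
    rw [LinearMap.mem_ker, map_nsmul, hx, hny]
  rw [hker, Submodule.mem_bot] at hnx
  have hx0 : (x : M) = 0 :=
    eq_zero_of_X_smul_eq_zero_of_nsmul_eq_zero hnf
      ((IwasawaAlgebra.mem_invariants_iff p M _).mp x.2) hn.ne'
      (by rw [← AddSubmonoidClass.coe_nsmul, hnx, ZeroMemClass.coe_zero])
  have hx0' : x = 0 := Subtype.ext hx0
  have hzero : ((y₁ - y₂ : AddCommGroup.torsion (IwasawaAlgebra.coinvariants p M)) :
      IwasawaAlgebra.coinvariants p M) = 0 := by
    rw [← hx, hx0', map_zero]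
  rwa [AddSubgroupClass.coe_sub] at hzero

end Algebra

/-! ## §3 The `η`-datum at a tower-onto pair -/

section Pair

variable {V : WeierstrassCurve ℚ} [V.IsElliptic] [V.IsGloballyMinimal] {p : ℕ} [Fact p.Prime]

/-- **`#(X_η/TX_η)_tors ∣ #coker φ_{X_η}` at a tower-onto pair.** GRANTED Kobayashi's Thm. 1.2 /
1.3 / 2.2(η) / 4.1(η) and Kitajima–Otsuki's Thm. 1.3 at `η` (NAMED facts), on a good `a_p = 0` pair
with `p ≥ 5`, `ρ_{V,p^m}` onto, the `V`-certificate and `coeff_r L_p⁺(V,η,T) ≠ 0`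
(`r = rank V^{(p*)}(ℚ)`): for every `η`-datum `D`, `ker φ_{D.X} = 0` (p502879's semisimplicity +
Kitajima–Otsuki) and the order of the torsion subgroup of `D.X/T·D.X` divides
`#coker(φ : D.X[T] → D.X/T·D.X)` (§2), hence divides the `r`-th coefficient of `Char(D.X)` up to a
unit (p502879). CONDITIONAL; asserts nothing on the size of the torsion.
[cite: Kobayashi2003, Thm. 2.2 (p. 5), Thm. 4.1 and §4 (p. 8)] [cite: KitajimaOtsuki2018, Thm. 1.3]
[cite: CoatesSchneiderSujatha2003, §3 (30)–(31)] -/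
theorem ker_bockstein_eq_bot_and_natCard_torsion_coinvariants_dvd
    (h12 : Kobayashi2003.thm12_signedSelmerDual_finite_torsion)
    (h13 : Kobayashi2003.thm41_signedCharIdeal_divisibility)
    (h22 : Kobayashi2003.thm22_etaSignedSelmerDual_finite_torsion)
    (h41 : Kobayashi2003.thm41_plusEtaCharIdeal_dvd)
    (hKO : KitajimaOtsuki2018.mainThm13_etaSignedSelmerDual_noFiniteSubmodule)
    (hp5 : 5 ≤ p) (hgood : V.HasGoodReductionAtPrime p) (hap : V.frobeniusTrace p = 0)
    (hsurj : ∀ m : ℕ, V.HasSurjectiveModNGaloisRep (p ^ m : ℕ))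
    (hcertV : ∀ {N : ℕ} [NeZero N] (f : CuspForm (Gamma0 N) 2), IsNewformOf V f →
      ∃ L : IwasawaAlgebra p, Kobayashi2003.IsSignedPAdicLFunction f p 1 L ∧
        IsUnit (PowerSeries.coeff V.mordellWeilRank L))
    {N : ℕ} [NeZero N] {f : CuspForm (Gamma0 N) 2} (hf : IsNewformOf V f) (ϖ : ℚ)
    (hϖ : if Even (p / 2) then (ϖ : ℝ) * V.realPeriodRat = plusPeriod f
      else (ϖ : ℝ) * V.imaginaryPeriodRat = minusPeriod f)
    (Lη : IwasawaAlgebra p) (hL : IsQuadraticBranchPlusLFunction f p ϖ Lη)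
    (hne : PowerSeries.coeff (V.quadraticTwist ((-1) ^ (p / 2) * p)).mordellWeilRank Lη ≠ 0)
    (K₀ : Type) [Field K₀] [NumberField K₀] [IsCyclotomicExtension {p} ℚ K₀]
    [(galRange (K := ℚ) K₀).Normal] (ηq : absoluteGaloisGroup ℚ →* ℤˣ)
    (hηK : ∀ σ ∈ galRange (K := ℚ) K₀, ηq σ = 1) (hη1 : ηq ≠ 1)
    (κ : ZpExtension ℚ p) (γ : absoluteGaloisGroup ℚ) (hκ : κ.IsCyclotomic) (hγ : κ.IsTopGenerator γ)
    (hγK : γ ∈ galRange (K := ℚ) K₀) (hγc : IsCyclotomicVariable p γ)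
    (D : EtaSignedSelmerDualData V κ K₀ ℚ_[p] ηq γ 1) :
    LinearMap.ker (IwasawaAlgebra.bockstein p D.X) = ⊥ ∧
      Nat.card (AddCommGroup.torsion (IwasawaAlgebra.coinvariants p D.X)) ∣
        Nat.card (IwasawaAlgebra.coinvariants p D.X ⧸
          LinearMap.range (IwasawaAlgebra.bockstein p D.X)) := by
  have hp2 : p ≠ 2 := by omega
  obtain ⟨hfin, htor⟩ :=
    EtaSignedSelmerDualData.finite_isTorsion_of_thm22 h22 hηK hp2 hgood hap hκ hγ hγK D
  haveI : Module.Finite (IwasawaAlgebra p) D.X := hfin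
  obtain ⟨g, hg⟩ := (charIdeal_isPrincipal_holds p D.X).principal
  have hg' : D.charIdeal = Ideal.span {g} := hg
  obtain ⟨-, hkfin⟩ :=
    order_eq_twistRank_and_finite_ker_bockstein_of_namedFacts_of_certV_of_coeff_ne_zero h12 h13 h22
      h41 hp5 hgood hap hsurj (fun f hf => hcertV f hf) hf ϖ hϖ Lη hL hne K₀ ηq hηK hη1 κ γ hκ hγ hγK
      hγc D hg'
  -- every finite `Λ`-submodule of `X_η` vanishes (Kitajima–Otsuki at `η`)
  have hnf : ∀ N : Submodule (IwasawaAlgebra p) D.X, Finite N → N = ⊥ :=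
    hKO p K₀ ηq hηK V hp2 hgood hap κ γ hκ hγ hγK 1 D.toLiterature hfin htor
  -- `ker φ = 0`
  haveI := hkfin
  have hmapfin : Finite ((LinearMap.ker (IwasawaAlgebra.bockstein p D.X)).map
      (IwasawaAlgebra.invariants p D.X).subtype) := by
    refine Finite.of_surjective
      (fun x : LinearMap.ker (IwasawaAlgebra.bockstein p D.X) =>
        (⟨(IwasawaAlgebra.invariants p D.X).subtype x, Submodule.mem_map_of_mem x.2⟩ :
          (LinearMap.ker (IwasawaAlgebra.bockstein p D.X)).map
            (IwasawaAlgebra.invariants p D.X).subtype)) ?_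
    rintro ⟨y, hy⟩
    obtain ⟨x, hx, rfl⟩ := Submodule.mem_map.mp hy
    exact ⟨⟨x, hx⟩, rfl⟩
  have hbot := hnf _ hmapfin
  have hker : LinearMap.ker (IwasawaAlgebra.bockstein p D.X) = ⊥ := by
    rw [Submodule.eq_bot_iff]
    intro x hx
    have hx' : (IwasawaAlgebra.invariants p D.X).subtype x ∈
        (LinearMap.ker (IwasawaAlgebra.bockstein p D.X)).map
          (IwasawaAlgebra.invariants p D.X).subtype := Submodule.mem_map_of_mem hx
    rw [hbot, Submodule.mem_bot, Submodule.subtype_apply] at hx'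
    exact Subtype.ext hx'
  exact ⟨hker, natCard_torsion_coinvariants_dvd_natCard_coker_bockstein hnf hker⟩

/-- **(E⁺_η) AT A TOWER-ONTO PAIR OF ANY RANK from the TORSION of the `Γ`-coinvariants.** GRANTED
Kobayashi's Thm. 1.2 / 1.3 / 2.2(η) / 4.1(η) and Kitajima–Otsuki's Thm. 1.3 at `η` (NAMED facts),
`p ≥ 5`, `V` good with `a_p = 0`, `ρ_{V,p^m}` onto, the `V`-certificate, ONE integer `v` with the
ANALYTIC certificate `p^{v+1} ∤ coeff_r L_p⁺(V,η,T)` and the input `p^v ∣ #(X_η/TX_η)_tors` for every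
`η`-datum (the Pontryagin dual of `Sel⁺(V/K₀ℚ_∞)^{η,Γ}` modulo its divisible part — the quantity the
bottom-layer control map of `W` sees): (E⁺_η)(V, p). For `r = 0` the torsion is ALL of `X_η/TX_η`
(k8-rung's road); for `r = 1` it is the OPEN per-pair content of crux 19601 in its most descended form
so far. CONDITIONAL; closes nothing. [cite: Kobayashi2003, Thm. 2.2 (p. 5), Thm. 4.1 and §4 (p. 8)]
[cite: KitajimaOtsuki2018, Thm. 1.3] [cite: CoatesSchneiderSujatha2003, §3 (30)–(31)] -/
theorem quadraticBranchPlusEtaLowerInclusionAt_of_namedFacts_of_certV_of_torsionCoinvariantsDvd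
    (h12 : Kobayashi2003.thm12_signedSelmerDual_finite_torsion)
    (h13 : Kobayashi2003.thm41_signedCharIdeal_divisibility)
    (h22 : Kobayashi2003.thm22_etaSignedSelmerDual_finite_torsion)
    (h41 : Kobayashi2003.thm41_plusEtaCharIdeal_dvd)
    (hKO : KitajimaOtsuki2018.mainThm13_etaSignedSelmerDual_noFiniteSubmodule)
    (hp5 : 5 ≤ p) (hgood : V.HasGoodReductionAtPrime p) (hap : V.frobeniusTrace p = 0)
    (hsurj : ∀ m : ℕ, V.HasSurjectiveModNGaloisRep (p ^ m : ℕ))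
    (hcertV : ∀ {N : ℕ} [NeZero N] (f : CuspForm (Gamma0 N) 2), IsNewformOf V f →
      ∃ L : IwasawaAlgebra p, Kobayashi2003.IsSignedPAdicLFunction f p 1 L ∧
        IsUnit (PowerSeries.coeff V.mordellWeilRank L))
    (v : ℕ)
    (han : ∀ {N : ℕ} [NeZero N] {f : CuspForm (Gamma0 N) 2}, IsNewformOf V f →
      ∀ (ϖ : ℚ), (if Even (p / 2) then (ϖ : ℝ) * V.realPeriodRat = plusPeriod f
          else (ϖ : ℝ) * V.imaginaryPeriodRat = minusPeriod f) →
      ∀ (Lη : IwasawaAlgebra p), IsQuadraticBranchPlusLFunction f p ϖ Lη →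
        ¬ (p : ℤ_[p]) ^ (v + 1) ∣
          PowerSeries.coeff (V.quadraticTwist ((-1) ^ (p / 2) * p)).mordellWeilRank Lη)
    (htors : ∀ (K₀ : Type) [Field K₀] [NumberField K₀] [IsCyclotomicExtension {p} ℚ K₀]
      [(galRange (K := ℚ) K₀).Normal] (ηq : absoluteGaloisGroup ℚ →* ℤˣ),
      (∀ σ ∈ galRange (K := ℚ) K₀, ηq σ = 1) → ηq ≠ 1 →
      ∀ (κ : ZpExtension ℚ p) (γ : absoluteGaloisGroup ℚ),
        κ.IsCyclotomic → κ.IsTopGenerator γ → γ ∈ galRange (K := ℚ) K₀ → IsCyclotomicVariable p γ →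
      ∀ (D : EtaSignedSelmerDualData V κ K₀ ℚ_[p] ηq γ 1),
        p ^ v ∣ Nat.card (AddCommGroup.torsion (IwasawaAlgebra.coinvariants p D.X))) :
    QuadraticBranchPlusEtaLowerInclusionAt V p := by
  intro K₀ _ _ _ _ ηq hηK hη1 N _ f hp2 hgood' hap' hf ϖ hϖ Lη hL κ γ hκ hγ hγK hγc D
  obtain ⟨hfin, htor⟩ :=
    EtaSignedSelmerDualData.finite_isTorsion_of_thm22 h22 hηK hp2 hgood' hap' hκ hγ hγK D
  haveI : Module.Finite (IwasawaAlgebra p) D.X := hfin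
  obtain ⟨g, hg⟩ := (charIdeal_isPrincipal_holds p D.X).principal
  have hg' : D.charIdeal = Ideal.span {g} := hg
  -- Kato side: `g ∣ Lη`
  obtain ⟨-, hup⟩ := EtaSignedSelmerDualData.thm41_plus_of_facts h22 h41 hηK hη1 hp2 hgood' hap' hf
    ϖ hϖ Lη hL hκ hγ hγK hγc D
  have hgL : g ∣ Lη := by
    have h := hup hsurj
    rw [hg', Ideal.span_singleton_le_span_singleton] at h
    exact h
  have hanL := han hf ϖ hϖ Lη hL
  have hne : PowerSeries.coeff (V.quadraticTwist ((-1) ^ (p / 2) * p)).mordellWeilRank Lη ≠ 0 :=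
    fun h0 => hanL (by rw [h0]; exact dvd_zero _)
  -- rank bound, leading coefficient, torsion divisibility
  have hXg := X_pow_twistRank_dvd_etaCharGenerator_of_namedFacts_of_certV h12 h13 h22 hp5 hgood hap
    hsurj (fun f hf => hcertV f hf) hf K₀ ηq hηK hη1 κ γ hκ hγ hγK hγc D hg'
  obtain ⟨u, hu⟩ := coeff_twistRank_etaCharGenerator_eq_unit_mul_card_coker_bockstein h12 h13 h22 h41
    hKO hp5 hgood hap hsurj (fun f hf => hcertV f hf) hf ϖ hϖ Lη hL hne K₀ ηq hηK hη1 κ γ hκ hγ hγK hγc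
    D hg'
  obtain ⟨-, hdvd⟩ := ker_bockstein_eq_bot_and_natCard_torsion_coinvariants_dvd h12 h13 h22 h41 hKO
    hp5 hgood hap hsurj (fun f hf => hcertV f hf) hf ϖ hϖ Lη hL hne K₀ ηq hηK hη1 κ γ hκ hγ hγK hγc D
  have halg : (p : ℤ_[p]) ^ v ∣
      PowerSeries.coeff (V.quadraticTwist ((-1) ^ (p / 2) * p)).mordellWeilRank g := by
    rw [hu]
    obtain ⟨c, hc⟩ := (htors K₀ ηq hηK hη1 κ γ hκ hγ hγK hγc D).trans hdvd
    refine Dvd.dvd.mul_left ?_ _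
    rw [hc, Nat.cast_mul, Nat.cast_pow]
    exact dvd_mul_right _ _
  -- squeeze
  have heq : Ideal.span {g} = Ideal.span {Lη} :=
    span_singleton_eq_of_X_pow_dvd_of_dvd_of_pow_dvd_coeff hXg hgL halg hanL
  rw [← heq, ← hg']

end Pair

end Summit.BirchSwinnertonDyer.BirchSwinnertonDyer.Theorems

end
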